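import Mathlib
import HarnessLib
import HarnessLib.Audit
import Summits.Langlands.Statement
import Summits.Langlands.Langlands.Theses.RootDecomp1
import Summits.Langlands.Langlands.Theses.IwahoriBlockSplit
set_option linter.dupNamespace false
set_option linter.unusedVariables false
set_option linter.unusedSectionVars false

/-!
# Birth skeleton (BC3) for crux `IwahoriBlockSplit.IwahoriBlockMatching` — line `birth` (PRE-BIRTH form: the cell is a local def with the
route text VERBATIM; after birth replace it by the route decl `Summit.Langlands.Langlands.Theses.IwahoriBlockSplit.IwahoriBlockMatching`).
Node `IwahoriBlockSplit` (decomp-langlands lens-2 g22; child route refining `RootDecomp1:SemisimpleMatchingOneDatum` stmt-Langlands-23600).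
Shape: stubs `theorem stub_<name> : <signature> := by sorry` (each a genuine lemma of the line — no stub restates the cell, S or the summit:
probes `probes_stubs_IwahoriBlockMatching.lean`), `namespace _Goal` naming each stub statement, and the kernel-checked composition
`IwahoriBlockMatching_of … : <the crux>`.  `lean check --json`: rc 0, sorries = the stubs (3), none elsewhere.
-/

open scoped BigOperators Topology Manifold Classical MeasureTheory ProbabilityTheory Matrix InnerProductSpace ComplexConjugate ContinuousMap
open Filter Set Function TopologicalSpace MeasureTheory

namespace Summit.Langlands.Langlands.Cruxes.IwahoriBlockMatching.Birth

/- POST-BIRTH (writer-1 g7): the cell is the route decl `Summit.Langlands.Langlands.Theses.IwahoriBlockSplit.IwahoriBlockMatching` (stmt-Langlands-28113) BY NAME; the pre-birth local `def IwahoriBlockMatching` (text VERBATIM = the route statement, sha12 cfc5ed7aa648) was removed. -/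

/-- stub · `stub_sphericalTwist` — IW ∩ «some local component π_v has a GL_n(𝒪_v)-fixed vector after a twist by a smooth character» (π_v UNRAMIFIED UP TO TWIST; the place is exceptional because ρ|_{Γ_{K_v}} is ramified or its Frobenius-semisimple eigenvalues are not read off yet): the claim is that ρ_v^{ss} ≅ (unramified with the Satake eigenvalues) ⊗ χ — monodromy may be non-zero (N is forgotten by S); PRINT for RA π over CM/totally-real K (Varma 2024 Thm 1 / Caraiani 2012), open beyond. -/
theorem stub_sphericalTwist :
    ∀ (K : Type) [Field K] [NumberField K], Nonempty (ReciprocityData K) → ∃ Rec : ReciprocityData K, ∀ (n : ℕ) (hcpt : Literature.NumberTheory.Automorphic.isCompact_glFiniteIntegralLevel n K), 0 < n → ∀ (π : Literature.NumberTheory.Automorphic.CuspidalAutomorphicRepData n K hcpt), π.1.IsLAlgebraic → ∀ (ℓ : ℕ) [Fact ℓ.Prime] (ι : PadicAlgCl ℓ ≃+* ℂ) (ρ : Literature.NumberTheory.GaloisRepresentations.FramedGaloisRep K (PadicAlgCl ℓ) n), ρ.toGaloisRep.IsIrreducible → ((∀ᶠ v : IsDedekindDomain.HeightOneSpectrum (NumberField.RingOfIntegers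 K) in cofinite, ρ.IsUnramifiedAt v) ∧ ∀ (v : IsDedekindDomain.HeightOneSpectrum (NumberField.RingOfIntegers K)) (hv : ((ℓ : ℕ) : NumberField.RingOfIntegers K) ∈ v.asIdeal), (Literature.NumberTheory.PAdicHodge.fontainePstAdicCompletion v ℓ hv).IsDeRhamFramed (ρ.toLocal v)) → (∀ᶠ v : IsDedekindDomain.HeightOneSpectrum (NumberField.RingOfIntegers K) in cofinite, SatakeFrobCompatibleAt ι π.1 ρ v) → ∀ v : IsDedekindDomain.HeightOneSpectrum (NumberField.RingOfIntegers K), ((ℓ : ℕ) : NumberField.RingOfIntegers K) ∉ v.asIdeal → ¬ SatakeFrobCompatibleAt ι π.1 ρ v → (∃ (πv : Literature.NumberTheory.Automorphic.SmoothIrrep (Matrix.GeneralLinearGroup (Fin n) (v.adicCompletion K))), π.1.HasLocalComponentAt v πv.ρ ∧ ∃ χ : Matrix.GeneralLinearGroup (Fin n) (v.adicCompletion K) →* ℂˣ, IsOpen (χ.ker : Set (Matrix.GeneralLinearGroup (Fin n) (v.adicCompletion K))) ∧ ∃ w : πv.V, w ≠ 0 ∧ ∀ g ∈ Literature.NumberTheory.Automorphic.iwahoriGL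 n (v.adicCompletion K), (πv.ρ.twist χ) g w = w) → (∃ (πv : Literature.NumberTheory.Automorphic.SmoothIrrep (Matrix.GeneralLinearGroup (Fin n) (v.adicCompletion K))), π.1.HasLocalComponentAt v πv.ρ ∧ ∃ χ : Matrix.GeneralLinearGroup (Fin n) (v.adicCompletion K) →* ℂˣ, IsOpen (χ.ker : Set (Matrix.GeneralLinearGroup (Fin n) (v.adicCompletion K))) ∧ ∃ w : πv.V, w ≠ 0 ∧ ∀ g ∈ Literature.NumberTheory.Automorphic.glInt n (v.adicCompletion K), (πv.ρ.twist χ) g w = w) → ∃ (πv : Literature.NumberTheory.Automorphic.SmoothIrrep (Matrix.GeneralLinearGroup (Fin n) (v.adicCompletion K))) (W : Literature.NumberTheory.GaloisRepresentations.WeilDeligneRep (v.adicCompletion K) (PadicAlgCl ℓ) (Fin n → (PadicAlgCl ℓ))) (Wℂ : Literature.NumberTheory.GaloisRepresentations.WeilDeligneRep (v.adicCompletion K) ℂ (Fin n → ℂ)) (S : Literature.NumberTheory.GaloisRepresentations.WeilDeligneRep (v.adicCompletion K) ℂ (Fin n → ℂ)) (hS : S.IsFrobSemisimple), π.1.HasLocalComponentAt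 v πv.ρ ∧ Literature.NumberTheory.GaloisRepresentations.IsWeilDeligneOfLadic (ρ.toLocal v).toWeilGroupHom W ∧ W.IsTransportAlong (ι : PadicAlgCl ℓ →+* ℂ) Wℂ ∧ Quotient.mk (Literature.NumberTheory.Automorphic.frobSemisimpleWDSetoid (v.adicCompletion K) n) ⟨S, hS⟩ = (Rec.llc v).recGL n (Literature.NumberTheory.Automorphic.IrrClass.mk πv) ∧ ∀ w : Literature.NumberTheory.GaloisRepresentations.WeilGroup (v.adicCompletion K), LinearMap.trace ℂ (Fin n → ℂ) (Wℂ.ρ w) = LinearMap.trace ℂ (Fin n → ℂ) (S.ρ w) := by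
  sorry

/-- stub · `stub_monodromicTwist` — IW ∩ «twisted-Iwahori but NOT spherical up to twist» (MONODROMIC places: generalized Steinberg / proper subquotients of unramified principal series up to twist — the semistable-reduction sector, where the host's N-side items RM/MonodromyUpgrade live): semisimple matching = «ρ_v^{ss} is a sum of unramified-twisted characters with the Bernstein–Zelevinsky exponents of π_v»; PRINT for RA∧(CM∨TR), open beyond. -/
theorem stub_monodromicTwist :
    ∀ (K : Type) [Field K] [NumberField K], Nonempty (ReciprocityData K) → ∃ Rec : ReciprocityData K, ∀ (n : ℕ) (hcpt : Literature.NumberTheory.Automorphic.isCompact_glFiniteIntegralLevel n K), 0 < n → ∀ (π : Literature.NumberTheory.Automorphic.CuspidalAutomorphicRepData n K hcpt), π.1.IsLAlgebraic → ∀ (ℓ : ℕ) [Fact ℓ.Prime] (ι : PadicAlgCl ℓ ≃+* ℂ) (ρ : Literature.NumberTheory.GaloisRepresentations.FramedGaloisRep K (PadicAlgCl ℓ) n), ρ.toGaloisRep.IsIrreducible → ((∀ᶠ v : IsDedekindDomain.HeightOneSpectrum (NumberField.RingOfIntegers K) in cofinite, ρ.IsUnramifiedAt v) ∧ ∀ (v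 : IsDedekindDomain.HeightOneSpectrum (NumberField.RingOfIntegers K)) (hv : ((ℓ : ℕ) : NumberField.RingOfIntegers K) ∈ v.asIdeal), (Literature.NumberTheory.PAdicHodge.fontainePstAdicCompletion v ℓ hv).IsDeRhamFramed (ρ.toLocal v)) → (∀ᶠ v : IsDedekindDomain.HeightOneSpectrum (NumberField.RingOfIntegers K) in cofinite, SatakeFrobCompatibleAt ι π.1 ρ v) → ∀ v : IsDedekindDomain.HeightOneSpectrum (NumberField.RingOfIntegers K), ((ℓ : ℕ) : NumberField.RingOfIntegers K) ∉ v.asIdeal → ¬ SatakeFrobCompatibleAt ι π.1 ρ v → (∃ (πv : Literature.NumberTheory.Automorphic.SmoothIrrep (Matrix.GeneralLinearGroup (Fin n) (v.adicCompletion K))), π.1.HasLocalComponentAt v πv.ρ ∧ ∃ χ : Matrix.GeneralLinearGroup (Fin n) (v.adicCompletion K) →* ℂˣ, IsOpen (χ.ker : Set (Matrix.GeneralLinearGroup (Fin n) (v.adicCompletion K))) ∧ ∃ w : πv.V, w ≠ 0 ∧ ∀ g ∈ Literature.NumberTheory.Automorphic.iwahoriGL n (v.adicCompletion K), (πv.ρ.twist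 χ) g w = w) → ¬ (∃ (πv : Literature.NumberTheory.Automorphic.SmoothIrrep (Matrix.GeneralLinearGroup (Fin n) (v.adicCompletion K))), π.1.HasLocalComponentAt v πv.ρ ∧ ∃ χ : Matrix.GeneralLinearGroup (Fin n) (v.adicCompletion K) →* ℂˣ, IsOpen (χ.ker : Set (Matrix.GeneralLinearGroup (Fin n) (v.adicCompletion K))) ∧ ∃ w : πv.V, w ≠ 0 ∧ ∀ g ∈ Literature.NumberTheory.Automorphic.glInt n (v.adicCompletion K), (πv.ρ.twist χ) g w = w) → ∃ (πv : Literature.NumberTheory.Automorphic.SmoothIrrep (Matrix.GeneralLinearGroup (Fin n) (v.adicCompletion K))) (W : Literature.NumberTheory.GaloisRepresentations.WeilDeligneRep (v.adicCompletion K) (PadicAlgCl ℓ) (Fin n → (PadicAlgCl ℓ))) (Wℂ : Literature.NumberTheory.GaloisRepresentations.WeilDeligneRep (v.adicCompletion K) ℂ (Fin n → ℂ)) (S : Literature.NumberTheory.GaloisRepresentations.WeilDeligneRep (v.adicCompletion K) ℂ (Fin n → ℂ)) (hS : S.IsFrobSemisimple), π.1.HasLocalComponentAt v πv.ρ ∧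 Literature.NumberTheory.GaloisRepresentations.IsWeilDeligneOfLadic (ρ.toLocal v).toWeilGroupHom W ∧ W.IsTransportAlong (ι : PadicAlgCl ℓ →+* ℂ) Wℂ ∧ Quotient.mk (Literature.NumberTheory.Automorphic.frobSemisimpleWDSetoid (v.adicCompletion K) n) ⟨S, hS⟩ = (Rec.llc v).recGL n (Literature.NumberTheory.Automorphic.IrrClass.mk πv) ∧ ∀ w : Literature.NumberTheory.GaloisRepresentations.WeilGroup (v.adicCompletion K), LinearMap.trace ℂ (Fin n → ℂ) (Wℂ.ρ w) = LinearMap.trace ℂ (Fin n → ℂ) (S.ρ w) := by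
  sorry

/-- stub · `stub_recRigidity` — R = host support `RootDecomp1.RecRigidity` 23603 BY NAME (two reciprocity data agree on local components of L-algebraic cuspidal π): reconciles the data chosen by the two sub-cells, exactly as in the node's `S_of_cells`. -/
theorem stub_recRigidity :
    Summit.Langlands.Langlands.Theses.RootDecomp1.RecRigidity := by
  sorry

namespace _Goal

/-- statement of `stub_sphericalTwist`. -/
def stub_sphericalTwist : Prop :=
  ∀ (K : Type) [Field K] [NumberField K], Nonempty (ReciprocityData K) → ∃ Rec : ReciprocityData K, ∀ (n : ℕ) (hcpt : Literature.NumberTheory.Automorphic.isCompact_glFiniteIntegralLevel n K), 0 < n → ∀ (π : Literature.NumberTheory.Automorphic.CuspidalAutomorphicRepData n K hcpt), π.1.IsLAlgebraic → ∀ (ℓ : ℕ) [Fact ℓ.Prime] (ι : PadicAlgCl ℓ ≃+* ℂ) (ρ : Literature.NumberTheory.GaloisRepresentations.FramedGaloisRep K (PadicAlgCl ℓ) n), ρ.toGaloisRep.IsIrreducible → ((∀ᶠ v : IsDedekindDomain.HeightOneSpectrum (NumberField.RingOfIntegers K) in cofinite, ρ.IsUnramifiedAt v) ∧ ∀ (v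 : IsDedekindDomain.HeightOneSpectrum (NumberField.RingOfIntegers K)) (hv : ((ℓ : ℕ) : NumberField.RingOfIntegers K) ∈ v.asIdeal), (Literature.NumberTheory.PAdicHodge.fontainePstAdicCompletion v ℓ hv).IsDeRhamFramed (ρ.toLocal v)) → (∀ᶠ v : IsDedekindDomain.HeightOneSpectrum (NumberField.RingOfIntegers K) in cofinite, SatakeFrobCompatibleAt ι π.1 ρ v) → ∀ v : IsDedekindDomain.HeightOneSpectrum (NumberField.RingOfIntegers K), ((ℓ : ℕ) : NumberField.RingOfIntegers K) ∉ v.asIdeal → ¬ SatakeFrobCompatibleAt ι π.1 ρ v → (∃ (πv : Literature.NumberTheory.Automorphic.SmoothIrrep (Matrix.GeneralLinearGroup (Fin n) (v.adicCompletion K))), π.1.HasLocalComponentAt v πv.ρ ∧ ∃ χ : Matrix.GeneralLinearGroup (Fin n) (v.adicCompletion K) →* ℂˣ, IsOpen (χ.ker : Set (Matrix.GeneralLinearGroup (Fin n) (v.adicCompletion K))) ∧ ∃ w : πv.V, w ≠ 0 ∧ ∀ g ∈ Literature.NumberTheory.Automorphic.iwahoriGL n (v.adicCompletion K), (πv.ρ.twist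 χ) g w = w) → (∃ (πv : Literature.NumberTheory.Automorphic.SmoothIrrep (Matrix.GeneralLinearGroup (Fin n) (v.adicCompletion K))), π.1.HasLocalComponentAt v πv.ρ ∧ ∃ χ : Matrix.GeneralLinearGroup (Fin n) (v.adicCompletion K) →* ℂˣ, IsOpen (χ.ker : Set (Matrix.GeneralLinearGroup (Fin n) (v.adicCompletion K))) ∧ ∃ w : πv.V, w ≠ 0 ∧ ∀ g ∈ Literature.NumberTheory.Automorphic.glInt n (v.adicCompletion K), (πv.ρ.twist χ) g w = w) → ∃ (πv : Literature.NumberTheory.Automorphic.SmoothIrrep (Matrix.GeneralLinearGroup (Fin n) (v.adicCompletion K))) (W : Literature.NumberTheory.GaloisRepresentations.WeilDeligneRep (v.adicCompletion K) (PadicAlgCl ℓ) (Fin n → (PadicAlgCl ℓ))) (Wℂ : Literature.NumberTheory.GaloisRepresentations.WeilDeligneRep (v.adicCompletion K) ℂ (Fin n → ℂ)) (S : Literature.NumberTheory.GaloisRepresentations.WeilDeligneRep (v.adicCompletion K) ℂ (Fin n → ℂ)) (hS : S.IsFrobSemisimple), π.1.HasLocalComponentAt v πv.ρ ∧ Literature.NumberTheory.GaloisRepresentations.IsWeilDeligneOfLadic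 (ρ.toLocal v).toWeilGroupHom W ∧ W.IsTransportAlong (ι : PadicAlgCl ℓ →+* ℂ) Wℂ ∧ Quotient.mk (Literature.NumberTheory.Automorphic.frobSemisimpleWDSetoid (v.adicCompletion K) n) ⟨S, hS⟩ = (Rec.llc v).recGL n (Literature.NumberTheory.Automorphic.IrrClass.mk πv) ∧ ∀ w : Literature.NumberTheory.GaloisRepresentations.WeilGroup (v.adicCompletion K), LinearMap.trace ℂ (Fin n → ℂ) (Wℂ.ρ w) = LinearMap.trace ℂ (Fin n → ℂ) (S.ρ w)

/-- statement of `stub_monodromicTwist`. -/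
def stub_monodromicTwist : Prop :=
  ∀ (K : Type) [Field K] [NumberField K], Nonempty (ReciprocityData K) → ∃ Rec : ReciprocityData K, ∀ (n : ℕ) (hcpt : Literature.NumberTheory.Automorphic.isCompact_glFiniteIntegralLevel n K), 0 < n → ∀ (π : Literature.NumberTheory.Automorphic.CuspidalAutomorphicRepData n K hcpt), π.1.IsLAlgebraic → ∀ (ℓ : ℕ) [Fact ℓ.Prime] (ι : PadicAlgCl ℓ ≃+* ℂ) (ρ : Literature.NumberTheory.GaloisRepresentations.FramedGaloisRep K (PadicAlgCl ℓ) n), ρ.toGaloisRep.IsIrreducible → ((∀ᶠ v : IsDedekindDomain.HeightOneSpectrum (NumberField.RingOfIntegers K) in cofinite, ρ.IsUnramifiedAt v) ∧ ∀ (v : IsDedekindDomain.HeightOneSpectrum (NumberField.RingOfIntegers K)) (hv : ((ℓ : ℕ) : NumberField.RingOfIntegers K) ∈ v.asIdeal), (Literature.NumberTheory.PAdicHodge.fontainePstAdicCompletion v ℓ hv).IsDeRhamFramed (ρ.toLocal v)) → (∀ᶠ v : IsDedekindDomain.HeightOneSpectrum (NumberField.RingOfIntegers K) in cofinite, SatakeFrobCompatibleAt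 ι π.1 ρ v) → ∀ v : IsDedekindDomain.HeightOneSpectrum (NumberField.RingOfIntegers K), ((ℓ : ℕ) : NumberField.RingOfIntegers K) ∉ v.asIdeal → ¬ SatakeFrobCompatibleAt ι π.1 ρ v → (∃ (πv : Literature.NumberTheory.Automorphic.SmoothIrrep (Matrix.GeneralLinearGroup (Fin n) (v.adicCompletion K))), π.1.HasLocalComponentAt v πv.ρ ∧ ∃ χ : Matrix.GeneralLinearGroup (Fin n) (v.adicCompletion K) →* ℂˣ, IsOpen (χ.ker : Set (Matrix.GeneralLinearGroup (Fin n) (v.adicCompletion K))) ∧ ∃ w : πv.V, w ≠ 0 ∧ ∀ g ∈ Literature.NumberTheory.Automorphic.iwahoriGL n (v.adicCompletion K), (πv.ρ.twist χ) g w = w) → ¬ (∃ (πv : Literature.NumberTheory.Automorphic.SmoothIrrep (Matrix.GeneralLinearGroup (Fin n) (v.adicCompletion K))), π.1.HasLocalComponentAt v πv.ρ ∧ ∃ χ : Matrix.GeneralLinearGroup (Fin n) (v.adicCompletion K) →* ℂˣ, IsOpen (χ.ker : Set (Matrix.GeneralLinearGroup (Fin n) (v.adicCompletion K))) ∧ ∃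 w : πv.V, w ≠ 0 ∧ ∀ g ∈ Literature.NumberTheory.Automorphic.glInt n (v.adicCompletion K), (πv.ρ.twist χ) g w = w) → ∃ (πv : Literature.NumberTheory.Automorphic.SmoothIrrep (Matrix.GeneralLinearGroup (Fin n) (v.adicCompletion K))) (W : Literature.NumberTheory.GaloisRepresentations.WeilDeligneRep (v.adicCompletion K) (PadicAlgCl ℓ) (Fin n → (PadicAlgCl ℓ))) (Wℂ : Literature.NumberTheory.GaloisRepresentations.WeilDeligneRep (v.adicCompletion K) ℂ (Fin n → ℂ)) (S : Literature.NumberTheory.GaloisRepresentations.WeilDeligneRep (v.adicCompletion K) ℂ (Fin n → ℂ)) (hS : S.IsFrobSemisimple), π.1.HasLocalComponentAt v πv.ρ ∧ Literature.NumberTheory.GaloisRepresentations.IsWeilDeligneOfLadic (ρ.toLocal v).toWeilGroupHom W ∧ W.IsTransportAlong (ι : PadicAlgCl ℓ →+* ℂ) Wℂ ∧ Quotient.mk (Literature.NumberTheory.Automorphic.frobSemisimpleWDSetoid (v.adicCompletion K) n) ⟨S, hS⟩ = (Rec.llc v).recGL n (Literature.NumberTheory.Automorphic.IrrClass.mk πv)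 ∧ ∀ w : Literature.NumberTheory.GaloisRepresentations.WeilGroup (v.adicCompletion K), LinearMap.trace ℂ (Fin n → ℂ) (Wℂ.ρ w) = LinearMap.trace ℂ (Fin n → ℂ) (S.ρ w)

/-- statement of `stub_recRigidity`. -/
def stub_recRigidity : Prop :=
  Summit.Langlands.Langlands.Theses.RootDecomp1.RecRigidity

end _Goal

/-- COMPOSITION (kernel-checked, no sorry): the stubs give the crux. -/
theorem IwahoriBlockMatching_of (h₁ : _Goal.stub_sphericalTwist) (h₂ : _Goal.stub_monodromicTwist) (h₃ : _Goal.stub_recRigidity) : Summit.Langlands.Langlands.Theses.IwahoriBlockSplit.IwahoriBlockMatching := by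
  intro K _ _ hne
  obtain ⟨Rec₁, g₁⟩ := h₁ K hne
  obtain ⟨Rec₂, g₂⟩ := h₂ K hne
  refine ⟨Rec₁, fun n hcpt hn π hπ ℓ _ ι ρ hirr hbox hae v hv hnc htw => ?_⟩
  by_cases hsph : (∃ (πv : Literature.NumberTheory.Automorphic.SmoothIrrep (Matrix.GeneralLinearGroup (Fin n) (v.adicCompletion K))), π.1.HasLocalComponentAt v πv.ρ ∧ ∃ χ : Matrix.GeneralLinearGroup (Fin n) (v.adicCompletion K) →* ℂˣ, IsOpen (χ.ker : Set (Matrix.GeneralLinearGroup (Fin n) (v.adicCompletion K))) ∧ ∃ w : πv.V, w ≠ 0 ∧ ∀ g ∈ Literature.NumberTheory.Automorphic.glInt n (v.adicCompletion K), (πv.ρ.twist χ) g w = w)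
  · exact g₁ n hcpt hn π hπ ℓ ι ρ hirr hbox hae v hv hnc htw hsph
  · obtain ⟨πv, W, Wℂ, S, hS, hloc, hWD, htr, hrec, htrace⟩ := g₂ n hcpt hn π hπ ℓ ι ρ hirr hbox hae v hv hnc htw hsph
    exact ⟨πv, W, Wℂ, S, hS, hloc, hWD, htr, hrec.trans (h₃ K Rec₂ Rec₁ n hcpt hn π hπ v πv hloc), htrace⟩

end Summit.Langlands.Langlands.Cruxes.IwahoriBlockMatching.Birth
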